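import Summits.QuantumFields.YangMills.Theorems.BalabanUVNodesN20ClassLawSeparationFromMoments
import Summits.QuantumFields.YangMills.Theorems.BalabanUVNodesN20BlockCaricatureSummableStatistic

/-!
# BalabanUVNodes ∕ N20·N19′·N21 — THE MOMENT TEST IN K3 STUB 2's OWN CONJUNCT SHAPE (FILE O): a two-run moment separation of ANY class statistic, infinitely often in `K`, excludes
# every `(Bad, W, shA, shB, Wsh, δ)` from `RelWeightBound ∧ ShellWeightBound ∧ (Core ∧ Summable δ)` on the same carriers — MY FILE N's Chebyshev sets against MY FILE C's
# «the faces force summable class-law gaps along EVERY admissible (t_K, S_K)»; no `lt_one`, no bundled `HybridNE7`, no caricature, no independence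

Cell `pub-ymgap` (HUMAN RULING D-0062 Track A; work-bound push D-0149, director-ym №197), width seat `pub-ymgap-dag-n20-w1` (gen 6) on node N20 = NE7b; key item K3⁸
`SpineGivenEndpointR13SepCoPHV` = stmt-QuantumFields-27366 (dag-lead KEY MAP v2, INBOX l.35754: `--kind proof --supports 27366 --as helper`; lineage key K3⁷ stmt-QuantumFields-20544 aside);
COUNT-NEUTRAL.  Bus: CLAIM-19 ∕ INTENT-24.  THEOREMS ONLY: no `def`, no `instance`, no `notation`, no `sorry`; imports MY FILE N `…N20ClassLawSeparationFromMoments` (p628223) and MY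
FILE C `…N20BlockCaricatureSummableStatistic` (p613526: `summable_classLawGap_of_faces`).

WHY.  K3⁸ v6 stub 2 (`stub_expansion13HV`) concludes, at a pinned spine reading, the faces `KeyedRelWeight cr ∧ KeyedShellWeight cr ∧ KeyedExtractionV cr ∧ KeyedCoreEdgeHolderD4V β cr rr`;
read at ONE guarded admissible tuple (with the rates premise and the crux's prefix discharged there) they give exactly the unbundled triple `RelWeightBound ∧ ShellWeightBound ∧ (Core ∧
Summable δ)` on that tuple's carriers — the shape of THIS file's conclusion (FILE N's §3 was stated for the bundled `HybridNE7`, which carries `lt_one ∀ K`).  So a consumer at the record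
instantiates `T := (crOfRecord₁₃V …).T`, `A`, `B` (dial-free: dag-n20-d's dictionary) and reads the test in the stub's own letters.
* ★ `exists_classSet_gap_ge_half` (from `8(V_A+V_B) ≤ (m_B−m_A)²` at `(K,t)`: a class set with gap `≥ ½`; FILE N §2) · ★★★ `not_faces_of_frequently_momentSeparated` (`l₀ ≥ 0`, weights `≥ 0`
  with positive totals on `|t| ≤ l₀`; `∃ᶠ K, ∃ t f m_A m_B, |t| ≤ l₀ ∧ m_A ≠ m_B ∧ 8(V_A+V_B) ≤ (m_B−m_A)²` ⇒ ¬∃ Bad W shA shB Wsh δ, the face triple; the admissible choice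
  `(t_K, S_K)` = the Chebyshev set where the hypothesis fires, `(0, ∅)` elsewhere, by classical choice).

HONEST FRAMING.  [folklore] Chebyshev ∕ [bookkeeping] over the tree's SHAPES BY NAME; the separation hypothesis is a HYPOTHESIS (nothing read at the record; whether the record's keyed
large-field count — or any statistic — separates is UNDECIDED and needs one-run LOWER bounds on large-field weights nobody has typed); proves NO estimate of Bałaban's; refutes NO
registered stub; nothing of Bałaban's asserted or instantiated.  NE7 ∕ NE7b ∕ NE7c NOT PRINTED for `d = 4`, NOT proved; N19 ∕ N20 ∕ N21 NOT discharged; K3⁸ (27366, v6 b4e55110ab73e679) ∕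
aside K3⁷ OPEN, no stub claimed; counts unmoved (typed 28∕28 · discharged 5∕27); no count claim.  One finite `𝕋⁴` programme at fixed `ε`, Bałaban AS PRINTED; the YM mass gap (Clay) is NOT
proved by any of this — R4 closes the conditional finite-𝕋⁴ rung `BalabanLadder.UV` only; NOT ℝ⁴, NOT OS.  No decl carries a cite tag.
-/

set_option autoImplicit false

noncomputable section

open Finset Filter Topology
open Literature.MathematicalPhysics.QuantumFieldTheory.Balaban1983to89
open T4WeightBudget (RelWeightBound)
open T4IndicatorShell (ShellWeightBound)
open Summit.QuantumFields.BalabanUV.T4Continuum.Spine.NE7 (Core)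
open Summit.QuantumFields.YangMills.BalabanUVNodes.N20ClassLawSeparationFromMoments (exists_classSet_abs_gap_ge_one_sub_moments)
open Summit.QuantumFields.YangMills.BalabanUVNodes.N20BlockCaricatureSummableStatistic (summable_classLawGap_of_faces)

namespace Summit.QuantumFields.YangMills.BalabanUVNodes.N20ClassLawSeparationFromMomentsFaces

variable {ι : Type*} [DecidableEq ι] {l₀ vol : ℝ} {T : ℕ → Finset ι} {A B : ℕ → ℝ → ι → ℝ}

omit [DecidableEq ι] in
/-- From a moment separation `8(V_A+V_B) ≤ (m_B − m_A)²`, `m_A ≠ m_B`, at `(K, t)`: a class set `E ⊆ T_K` with gap `|(Σ_E B)∕Z_B − (Σ_E A)∕Z_A| ≥ ½` (FILE N §2). [folklore] -/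
theorem exists_classSet_gap_ge_half (K : ℕ) (t : ℝ) (hA0 : ∀ τ ∈ T K, 0 ≤ A K t τ) (hB0 : ∀ τ ∈ T K, 0 ≤ B K t τ)
    (hZA : 0 < ∑ τ ∈ T K, A K t τ) (hZB : 0 < ∑ τ ∈ T K, B K t τ) {f : ι → ℝ} {mA mB : ℝ} (hm : mA ≠ mB)
    (hV : 8 * ((∑ τ ∈ T K, A K t τ / (∑ σ ∈ T K, A K t σ) * (f τ - mA) ^ 2) + (∑ τ ∈ T K, B K t τ / (∑ σ ∈ T K, B K t σ) * (f τ - mB) ^ 2)) ≤ (mB - mA) ^ 2) :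
    ∃ E, E ⊆ T K ∧ (1 : ℝ) / 2 ≤ |(∑ τ ∈ E, B K t τ) / (∑ τ ∈ T K, B K t τ) - (∑ τ ∈ E, A K t τ) / (∑ τ ∈ T K, A K t τ)| := by
  obtain ⟨E, hE, hgap⟩ := exists_classSet_abs_gap_ge_one_sub_moments (T K) (A K t) (B K t) f hA0 hB0 hZA hZB hm
  refine ⟨E, hE, ?_⟩
  have hΔ : 0 < (mB - mA) ^ 2 := by have : mB - mA ≠ 0 := sub_ne_zero.2 hm.symm; positivity
  have hhalf : (1 : ℝ) / 2 ≤ 1 - 4 * ((∑ τ ∈ T K, A K t τ / (∑ σ ∈ T K, A K t σ) * (f τ - mA) ^ 2) +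
      (∑ τ ∈ T K, B K t τ / (∑ σ ∈ T K, B K t σ) * (f τ - mB) ^ 2)) / (mB - mA) ^ 2 := by
    rw [le_sub_comm, div_le_iff₀ hΔ]; linarith
  rw [abs_sub_comm]
  exact hhalf.trans hgap

/-- ★★★ **NO FACE TRIPLE FROM TWO MOMENTS** (the edition in K3 stub 2's OWN conjunct shape) [folklore ∕ bookkeeping]: carriers `T_K`, class weights `A, B ≥ 0` with positive totals on the
window `|t| ≤ l₀` (`l₀ ≥ 0`).  If infinitely often in `K` some admissible `t`, some class statistic `f` and centres `m_A ≠ m_B` satisfy `8(V_A + V_B) ≤ (m_B − m_A)²`, then NO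
`(Bad, W, shA, shB, Wsh, δ)` gives `RelWeightBound ∧ ShellWeightBound ∧ (Core … δ ∧ Summable δ)` — MY FILE C `summable_classLawGap_of_faces` (the faces force SUMMABLE class-law gaps
along EVERY admissible choice `(t_K, S_K)`) against the `½`-separated Chebyshev sets chosen where the hypothesis fires (`S_K := ∅` elsewhere). -/
theorem not_faces_of_frequently_momentSeparated (hl₀ : 0 ≤ l₀)
    (hA0 : ∀ (K : ℕ) (t : ℝ), |t| ≤ l₀ → ∀ τ ∈ T K, 0 ≤ A K t τ) (hB0 : ∀ (K : ℕ) (t : ℝ), |t| ≤ l₀ → ∀ τ ∈ T K, 0 ≤ B K t τ)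
    (hZA : ∀ (K : ℕ) (t : ℝ), |t| ≤ l₀ → 0 < ∑ τ ∈ T K, A K t τ) (hZB : ∀ (K : ℕ) (t : ℝ), |t| ≤ l₀ → 0 < ∑ τ ∈ T K, B K t τ)
    (hsep : ∃ᶠ K in atTop, ∃ (t : ℝ) (f : ι → ℝ) (mA mB : ℝ), |t| ≤ l₀ ∧ mA ≠ mB ∧
      8 * ((∑ τ ∈ T K, A K t τ / (∑ σ ∈ T K, A K t σ) * (f τ - mA) ^ 2) + (∑ τ ∈ T K, B K t τ / (∑ σ ∈ T K, B K t σ) * (f τ - mB) ^ 2)) ≤ (mB - mA) ^ 2) :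
    ¬ ∃ (Bad : ℕ → ℝ → Finset ι) (W : ℕ → ℝ) (shA shB : ℕ → ℝ → ι → ℝ) (Wsh δ : ℕ → ℝ),
      RelWeightBound l₀ T A B Bad W ∧ ShellWeightBound l₀ T A B shA shB Wsh ∧
      (Core l₀ vol T Bad (fun K t τ => A K t τ - shA K t τ) (fun K t τ => B K t τ - shB K t τ) δ ∧ Summable δ) := by
  rintro ⟨Bad, W, shA, shB, Wsh, δ, hW, hSh, hcore, hδ⟩
  -- where the hypothesis fires, a `½`-separated class set at an admissible source value
  have hsep' : ∃ᶠ K in atTop, ∃ (t : ℝ) (E : Finset ι), |t| ≤ l₀ ∧ E ⊆ T K ∧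
      (1 : ℝ) / 2 ≤ |(∑ τ ∈ E, B K t τ) / (∑ τ ∈ T K, B K t τ) - (∑ τ ∈ E, A K t τ) / (∑ τ ∈ T K, A K t τ)| :=
    hsep.mono fun K ⟨t, f, mA, mB, ht, hm, hV⟩ => by
      obtain ⟨E, hE, hgap⟩ := exists_classSet_gap_ge_half K t (hA0 K t ht) (hB0 K t ht) (hZA K t ht) (hZB K t ht) hm hV
      exact ⟨t, E, ht, hE, hgap⟩
  -- choose `(t_K, S_K)` there, `(0, ∅)` elsewhere
  classical
  let P : ℕ → Prop := fun K => ∃ (t : ℝ) (E : Finset ι), |t| ≤ l₀ ∧ E ⊆ T K ∧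
      (1 : ℝ) / 2 ≤ |(∑ τ ∈ E, B K t τ) / (∑ τ ∈ T K, B K t τ) - (∑ τ ∈ E, A K t τ) / (∑ τ ∈ T K, A K t τ)|
  let tS : ℕ → ℝ × Finset ι := fun K => if h : P K then (h.choose, h.choose_spec.choose) else (0, ∅)
  have htS : ∀ K, |(tS K).1| ≤ l₀ ∧ (tS K).2 ⊆ T K := fun K => by
    by_cases h : P K
    · simp only [tS, dif_pos h]
      exact ⟨h.choose_spec.choose_spec.1, h.choose_spec.choose_spec.2.1⟩
    · simp only [tS, dif_neg h, abs_zero]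
      exact ⟨hl₀, Finset.empty_subset _⟩
  have hfire : ∀ K, P K → (1 : ℝ) / 2 ≤
      |(∑ τ ∈ (tS K).2, B K (tS K).1 τ) / (∑ τ ∈ T K, B K (tS K).1 τ) - (∑ τ ∈ (tS K).2, A K (tS K).1 τ) / (∑ τ ∈ T K, A K (tS K).1 τ)| := fun K h => by
    simp only [tS, dif_pos h]
    exact h.choose_spec.choose_spec.2.2
  -- the faces make the gaps along `(t_K, S_K)` summable, hence eventually `< ½`
  have hsum := summable_classLawGap_of_faces (vol := vol) hW hSh hcore hδ hZA (fun K => (tS K).1) (fun K => (htS K).1) (fun K => (tS K).2) (fun K => (htS K).2)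
  have hev : ∀ᶠ K in atTop, |(∑ τ ∈ (tS K).2, B K (tS K).1 τ) / (∑ τ ∈ T K, B K (tS K).1 τ) -
      (∑ τ ∈ (tS K).2, A K (tS K).1 τ) / (∑ τ ∈ T K, A K (tS K).1 τ)| < 1 / 2 := by
    exact (tendsto_order.1 hsum.tendsto_atTop_zero).2 (1 / 2) (by norm_num)
  obtain ⟨K, hPK, hK⟩ := (hsep'.and_eventually hev).exists
  have := hfire K hPK
  linarith

end Summit.QuantumFields.YangMills.BalabanUVNodes.N20ClassLawSeparationFromMomentsFaces

end
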